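import Literature.NumberTheory.QuadraticForms.HasseInvariantReciprocity
import Literature.NumberTheory.QuadraticForms.RatPlacesDictionary
import Literature.NumberTheory.QuadraticForms.LocalQuadraticSpaceClassification
import Literature.NumberTheory.QuadraticForms.HasseMinkowskiIsometryRat
import Literature.NumberTheory.QuadraticForms.HasseProductBlocks
import HarnessLib

/-!
# The anisotropic places of a rational quaternary form of square discriminant are even in number
# (Serre IV §2.2 Thm 6 (iii) with §3.3 Remark (1))

Topic `NumberTheory/QuadraticForms`; namespace `Literature.NumberTheory.QuadraticForms`. Everything here
is proved. Serre, *A Course in Arithmetic*, Ch. IV §2.2 Thm 6: over `ℚ_v` a nondegenerate form of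
rank `4` represents `0` iff "`d ≠ 1`, or `d = 1` and `ε = (-1,-1)`" — so a quaternary form with square
discriminant (`d = 1`) is anisotropic at `v` exactly when `ε_v ≠ (-1,-1)_v`, i.e. `ε_v · (-1,-1)_v = -1`;
and §3.3 Remark (1): "`ε_v(f) = 1` for almost all `v` and `∏ ε_v(f) = 1`", together with Hilbert's
product formula for `(-1,-1)_v` (Ch. III §2.1 Thm 3). Hence: **the places `v` of `ℚ` at which a rational
quaternary diagonal form of square discriminant does not represent `0` are finite and even in number**
(these are the norm forms of quaternion algebras; the statement is the parity of the ramification set).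
The sign `ε_v · (-1,-1)_v` is realised as the Hasse invariant of the padded form `⟨-1, -1, c⟩`, to which
`rat_hasseProd_places_even` (`HasseInvariantReciprocity.lean`) applies.

* `rat_quaternary_anisotropic_places_even` — in the `ℚ_v` / `ℚ_w` language;
* `rat_quaternary_anisotropic_primes` — in the `ℚ_[p]` / `ℝ` language: a finite set `S` of primes with
  `p ∈ S ↔ ⟨c⟩` anisotropic over `ℚ_p`, and `#S` even iff `⟨c⟩` is isotropic over `ℝ`.

## References

* J.-P. Serre, *A Course in Arithmetic*, GTM 7, Springer 1973, Ch. IV §2.2 Thm 6 (iii), §3.3 Remark (1)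
  [corpus:book:serre1973-course-arithmetic p0037, p0042]. [Serre1973]
-/

noncomputable section

open Finset NumberField IsDedekindDomain

namespace Literature.NumberTheory.QuadraticForms

/-! ### The padded form `⟨-1, -1, c₀, …, c₃⟩` -/

section Pad

variable {L : Type*} [Field L]

/-- The padded coefficients are non-zero. [folklore] -/
private theorem pad_ne_zero {c : Fin 4 → L} (hc : ∀ i, c i ≠ 0) (i : Fin 6) :
    (Fin.cons (-1) (Fin.cons (-1) c : Fin 5 → L) : Fin 6 → L) i ≠ 0 := by
  refine Fin.cases ?_ (fun j => Fin.cases ?_ (fun k => ?_) j) i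
  · simp
  · simp
  · simpa using hc k

/-- `ε(⟨-1, -1, c⟩) = (-1,-1) · ε(c)` when `d(c)` is a non-zero square (two applications of
`hasseProd_cons`). [folklore] -/
private theorem hasseProd_pad (hL : IsRegularHilbertField L) {c : Fin 4 → L} (hc : ∀ i, c i ≠ 0) {t : L}
    (ht : t ≠ 0) (hd : ∏ i, c i = t ^ 2) :
    hasseProd (hilbertSymbol L) (Fin.cons (-1) (Fin.cons (-1) c : Fin 5 → L) : Fin 6 → L) =
      hilbertSymbol L (-1) (-1) * hasseProd (hilbertSymbol L) c := by
  haveI : NeZero (2 : L) := ⟨hL.two_ne_zero⟩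
  have h1 : (-1 : L) ≠ 0 := neg_ne_zero.mpr one_ne_zero
  have hc5 : ∀ i : Fin 5, (Fin.cons (-1) c : Fin 5 → L) i ≠ 0 := fun i =>
    Fin.cases (by simp) (fun j => by simpa using hc j) i
  rw [hasseProd_cons hL.isHasseSymbol h1 hc5, hasseProd_cons hL.isHasseSymbol h1 hc, Fin.prod_cons, hd,
    hilbertSymbol_mul_sq_right _ _ ht, show (t ^ 2 : L) = 1 * t ^ 2 by ring,
    hilbertSymbol_mul_sq_right _ _ ht, hilbertSymbol_one_right, one_mul]

/-- **Rank 4, `d = 1`: anisotropic iff `(-1,-1) · ε = -1`** (Serre, Ch. IV §2.2 Thm 6 (iii)), i.e. iff the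
padded form `⟨-1, -1, c⟩` has Hasse invariant `-1`; over any regular Hilbert field.
[cite: Serre1973, Ch. IV §2.2 Thm 6 (iii)] -/
private theorem not_diagIsotropic_iff_hasseProd_pad (hL : IsRegularHilbertField L) {c : Fin 4 → L}
    (hc : ∀ i, c i ≠ 0) {t : L} (ht : t ≠ 0) (hd : ∏ i, c i = t ^ 2) :
    ¬ DiagIsotropic c ↔
      hasseProd (hilbertSymbol L) (Fin.cons (-1) (Fin.cons (-1) c : Fin 5 → L) : Fin 6 → L) = -1 := by
  haveI : NeZero (2 : L) := ⟨hL.two_ne_zero⟩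
  rw [hL.diagIsotropic_four_iff hc, hasseProd_pad hL hc ht hd, not_or, not_not]
  have hsq : IsSquare (∏ i, c i) := ⟨t, by rw [hd, sq]⟩
  have hε : hasseProd (hilbertSymbol L) c = 1 ∨ hasseProd (hilbertSymbol L) c = -1 :=
    mul_self_eq_one_iff.mp (hasseProd_mul_self hL.isHasseSymbol c hc)
  rcases hilbertSymbol_eq_one_or_eq_neg_one (-1 : L) (-1) with h | h <;>
    rcases hε with h' | h' <;> simp [h, h', hsq]

/-- The same with the padded form given by its values (no `Fin.cons` matching needed downstream).
[cite: Serre1973, Ch. IV §2.2 Thm 6 (iii)] -/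
private theorem not_diagIsotropic_iff_hasseProd_six (hL : IsRegularHilbertField L) {c : Fin 4 → L}
    (hc : ∀ i, c i ≠ 0) {t : L} (ht : t ≠ 0) (hd : ∏ i, c i = t ^ 2) {c₆ : Fin 6 → L}
    (h0 : c₆ 0 = -1) (h1 : c₆ 1 = -1) (h6 : ∀ k : Fin 4, c₆ k.succ.succ = c k) :
    ¬ DiagIsotropic c ↔ hasseProd (hilbertSymbol L) c₆ = -1 := by
  have hc₆ : c₆ = (Fin.cons (-1) (Fin.cons (-1) c : Fin 5 → L) : Fin 6 → L) := by
    funext i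
    refine Fin.cases ?_ (fun j => Fin.cases ?_ (fun k => ?_) j) i
    · simpa using h0
    · simpa using h1
    · simpa using h6 k
  subst hc₆
  exact not_diagIsotropic_iff_hasseProd_pad hL hc ht hd

end Pad

/-! ### Over `ℚ`: all places -/


/-- **The anisotropic places of a rational quaternary form of square discriminant are finite and even in
number** (Serre, Ch. IV §2.2 Thm 6 (iii) at each place, §3.3 Remark (1) for `ε_v` and Hilbert's product
formula for `(-1,-1)_v`): for `c : Fin 4 → ℚ`, all `cᵢ ≠ 0`, `∏ cᵢ` a square, the finite places `v` with
`⟨c⟩` anisotropic over `ℚ_v` form a finite set which, counted together with the infinite place if `⟨c⟩`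
is anisotropic over `ℚ_∞`, is even. [cite: Serre1973, Ch. IV §2.2 Thm 6 (iii) and §3.3 Remark (1)] -/
theorem rat_quaternary_anisotropic_places_even {c : Fin 4 → ℚ} (hc : ∀ i, c i ≠ 0)
    (hd : IsSquare (∏ i, c i)) :
    {v : HeightOneSpectrum (𝓞 ℚ) |
        ¬ DiagIsotropic (fun i => algebraMap ℚ (v.adicCompletion ℚ) (c i))}.Finite ∧
      Even ({v : HeightOneSpectrum (𝓞 ℚ) |
          ¬ DiagIsotropic (fun i => algebraMap ℚ (v.adicCompletion ℚ) (c i))}.ncard +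
        {w : InfinitePlace ℚ | ¬ DiagIsotropic (fun i => algebraMap ℚ w.Completion (c i))}.ncard) := by
  obtain ⟨t, ht⟩ := hd
  have ht0 : t ≠ 0 := by
    rintro rfl
    exact (prod_ne_zero_iff.mpr fun i _ => hc i) (by simpa using ht)
  have hdt : ∏ i, c i = t ^ 2 := by rw [ht, sq]
  -- the padded form and its product formula
  set c' : Fin 6 → ℚ := Fin.cons (-1) (Fin.cons (-1) c : Fin 5 → ℚ) with hc'def
  have hc' : ∀ i, c' i ≠ 0 := pad_ne_zero hc
  obtain ⟨hfin, heven⟩ := rat_hasseProd_places_even c' hc'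
  -- finite places: anisotropic iff `ε_v(c') = -1`
  have hfinset : {v : HeightOneSpectrum (𝓞 ℚ) |
      ¬ DiagIsotropic (fun i => algebraMap ℚ (v.adicCompletion ℚ) (c i))} =
      {v : HeightOneSpectrum (𝓞 ℚ) | hasseProd (hilbertSymbol (v.adicCompletion ℚ))
        (fun i => algebraMap ℚ (v.adicCompletion ℚ) (c' i)) = -1} := by
    ext v
    simp only [Set.mem_setOf_eq]
    have hinj := (algebraMap ℚ (v.adicCompletion ℚ)).injective
    exact not_diagIsotropic_iff_hasseProd_six (isRegularHilbertField_adicCompletion ℚ v)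
      (c := fun i => algebraMap ℚ (v.adicCompletion ℚ) (c i))
      (fun i => (map_ne_zero_iff _ hinj).mpr (hc i)) ((map_ne_zero_iff _ hinj).mpr ht0)
      (by rw [← map_prod, hdt, map_pow]) (by simp [hc'def]) (by simp [hc'def]) (fun k => by simp [hc'def])
  -- the infinite place: through `ℚ_w ≃ ℝ`
  have hinfset : {w : InfinitePlace ℚ | ¬ DiagIsotropic (fun i => algebraMap ℚ w.Completion (c i))} =
      {w : InfinitePlace ℚ | hasseProd (hilbertSymbol w.Completion)
        (fun i => algebraMap ℚ w.Completion (c' i)) = -1} := by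
    ext w
    simp only [Set.mem_setOf_eq]
    rw [diagIsotropic_infinitePlace_rat_iff, hasseProd_infinitePlace_rat_eq]
    exact not_diagIsotropic_iff_hasseProd_six isRegularHilbertField_real (c := fun i => (c i : ℝ))
      (fun i => by simpa using hc i) (by simpa using ht0 : (t : ℝ) ≠ 0)
      (by rw [← Rat.cast_prod, hdt, Rat.cast_pow]) (by simp [hc'def]) (by simp [hc'def])
      (fun k => by simp [hc'def])
  rw [hfinset, hinfset]
  exact ⟨hfin, heven⟩

/-- **The anisotropic primes of a rational quaternary form of square discriminant** (the same in the
`ℚ_[p]` / `ℝ` language, along the dictionary of `RatPlacesDictionary.lean`): there is a finite set `S`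
of primes with `p ∈ S` iff `⟨c⟩` does not represent `0` over `ℚ_p`, and `#S` is even iff `⟨c⟩`
represents `0` over `ℝ`. [cite: Serre1973, Ch. IV §2.2 Thm 6 (iii) and §3.3 Remark (1)] -/
theorem rat_quaternary_anisotropic_primes {c : Fin 4 → ℚ} (hc : ∀ i, c i ≠ 0)
    (hd : IsSquare (∏ i, c i)) :
    ∃ S : Finset ℕ, (∀ p ∈ S, p.Prime) ∧
      (∀ (p : ℕ) [Fact p.Prime], p ∈ S ↔ ¬ DiagIsotropic (fun i => (c i : ℚ_[p]))) ∧
      (Even S.card ↔ DiagIsotropic (fun i => (c i : ℝ))) := by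
  classical
  obtain ⟨hfin, heven⟩ := rat_quaternary_anisotropic_places_even hc hd
  -- the infinite place
  have hinf : {w : InfinitePlace ℚ | ¬ DiagIsotropic (fun i => algebraMap ℚ w.Completion (c i))}.ncard =
      if DiagIsotropic (fun i => (c i : ℝ)) then 0 else 1 := by
    have hset' : {w : InfinitePlace ℚ | ¬ DiagIsotropic (fun i => algebraMap ℚ w.Completion (c i))} =
        if DiagIsotropic (fun i => (c i : ℝ)) then ∅ else Set.univ := by
      ext w
      simp only [Set.mem_setOf_eq, diagIsotropic_infinitePlace_rat_iff]
      split_ifs with h <;> simp [h]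
    rw [hset']
    split_ifs
    · exact Set.ncard_empty _
    · rw [Set.ncard_univ, Nat.card_unique]
  -- the finite set of primes
  refine ⟨hfin.toFinset.image fun v => (Rat.HeightOneSpectrum.primesEquiv (R := 𝓞 ℚ) v : ℕ),
    fun p hp => ?_, fun p hp => ?_, ?_⟩
  · obtain ⟨v, -, rfl⟩ := Finset.mem_image.mp hp
    exact (Rat.HeightOneSpectrum.primesEquiv (R := 𝓞 ℚ) v).2
  · obtain ⟨v, hv⟩ := (Rat.HeightOneSpectrum.primesEquiv (R := 𝓞 ℚ)).surjective ⟨p, hp.out⟩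
    have hvp : (Rat.HeightOneSpectrum.primesEquiv (R := 𝓞 ℚ) v : ℕ) = p := congrArg Subtype.val hv
    subst hvp
    rw [← diagIsotropic_adicCompletion_rat_iff v c, Finset.mem_image]
    constructor
    · rintro ⟨v', hv', h'⟩
      have hvv : v' = v := (Rat.HeightOneSpectrum.primesEquiv (R := 𝓞 ℚ)).injective (Subtype.ext h')
      subst hvv
      exact (Set.Finite.mem_toFinset hfin).mp hv'
    · intro h
      exact ⟨v, (Set.Finite.mem_toFinset hfin).mpr h, rfl⟩
  · have hinj : Function.Injective fun v : HeightOneSpectrum (𝓞 ℚ) =>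
        (Rat.HeightOneSpectrum.primesEquiv (R := 𝓞 ℚ) v : ℕ) := fun v v' h =>
      (Rat.HeightOneSpectrum.primesEquiv (R := 𝓞 ℚ)).injective (Subtype.ext h)
    rw [Finset.card_image_of_injective _ hinj, ← Set.ncard_eq_toFinset_card _ hfin]
    rw [hinf] at heven
    split_ifs at heven with h
    · simpa [h] using heven
    · simp only [h, iff_false, Nat.not_even_iff_odd]
      exact (Nat.even_add_one.mp heven |> Nat.not_even_iff_odd.mp)

end Literature.NumberTheory.QuadraticForms

end
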